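import Mathlib
import HarnessLib
import Literature.Geometry.DiscreteGeometry.ConvexHullFacets
import Summits.AtomisticToContinuum.Crystallization.Theorems.PricedLinkCensusSoftFourRingsThreeTriQuad
import Summits.AtomisticToContinuum.Crystallization.Theorems.PricedLinkCensusSoftFourRingsCapFacetCap
import Summits.AtomisticToContinuum.Crystallization.Theorems.PricedLinkCensusSoftFourRingsFacetFour

/-!
# Facets of the hull of the twelve link directions are triangles or quadrilaterals

Route `PricedLinkCensus`, item `SoftFourRings` (stmt-AtomisticToContinuum-14234), evidence
`softrings-search.md` §12.  Five points of `X` cannot be tight for one supporting functional `c`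
(`⟪c, ·⟫ ≤ 1` on `X`, `= 1` at the five): they would be cocircular on the circle of angular radius
`R`, `cos² R = 1/‖c‖²`, and pairwise `≥ 59.35°` apart, so their azimuths about the axis would be
pairwise `≥ arccos μ` apart with `μ = (ca − cos² R)/(1 − cos² R)`; under Tammes-13 (`FacetCap`:
`cos² R > 0.2938`) `μ < 0.306 < cos 72°`, and five azimuths pairwise more than `72°` apart do not fit
on a circle.  Hence every tight set — in particular every facet of `conv X` and its vertex count `m_f`
in Legendre's identity `Σ_f m_f = 2#X + 2#facets − 4` — has at most four points
(`card_tightSet_le_four_of_twelve_le_card`, CONDITIONAL on `musinTarasov2012_tammes_thirteen`), so the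
hull of the twelve directions consists of triangles and at most six quadrilaterals.

Contents: `five_sorted_false` / `five_circle_false` (circle), `tight_five_false` (sphere, general
constants), `card_tightSet_le_four_of_twelve_le_card` (the `η = 1/100` window with Tammes-13).

**`Cap` variant** (seat c3 of stmt-AtomisticToContinuum-14234): identical to `PricedLinkCensusSoftFourRingsFacetFour`, except that the
global Tammes-13 hypothesis `(hT : musinTarasov2012_tammes_thirteen)` is replaced by the LOCAL covering
property of the twelve directions, `hT : ∀ p, ‖p‖ = 1 → ∃ x ∈ X, dist p x < 0.957` (no empty cap of
angular radius `57.18°`), which is all the two roots (`FacetCap`, `Interior`) ever used; the hT-free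
lemmas are not repeated (the original file is imported for them).
-/

namespace Summit.AtomisticToContinuum.Crystallization.Theorems.Cap

open Real RealInnerProductSpace Literature.Geometry.DiscreteGeometry

/-- **Every facet (indeed every tight set) of the twelve link directions has at most four points**
(conditional on Tammes-13).  For at least twelve unit vectors pairwise at inner product
`≤ ca = 1 − 1/(2·(101/100)²)` (angle `≥ 59.35°`, so chord `≥ 0.99 ≥ 0.957`) and any functional with
`⟪c, ·⟫ ≤ 1` on `X`: `#(tightSet X c) ≤ 4`.  With `FacetCap`: `1/‖c‖² > ((2 − 0.957²)/2)² ≈ 0.2938`,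
so `μ = (ca − 0.2938…)/(1 − 0.2938…) ≈ 0.3059 < cos 72° ≈ 0.3090`.
[cite: MusinTarasov2012, Theorem 1] -/
theorem card_tightSet_le_four_of_twelve_le_card {X : Finset (EuclideanSpace ℝ (Fin 3))}
    (hT : ∀ p : EuclideanSpace ℝ (Fin 3), ‖p‖ = 1 → ∃ x ∈ X, dist p x < 0.957)
    (hX1 : ∀ y ∈ X, ‖y‖ = 1) (hcard : 12 ≤ X.card)
    (hsep : ∀ u ∈ X, ∀ v ∈ X, u ≠ v → ⟪u, v⟫ ≤ 1 - 1 / (2 * (101 / 100 : ℝ) ^ 2))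
    {c : EuclideanSpace ℝ (Fin 3)} (hc : ∀ y ∈ X, ⟪c, y⟫ ≤ 1) : (tightSet X c).card ≤ 4 := by
  classical
  by_contra h5
  push Not at h5
  -- chordal separation and the Tammes bound on `‖c‖`
  have hdist : ∀ u ∈ X, ∀ v ∈ X, u ≠ v → (0.957 : ℝ) ≤ dist u v := by
    intro u hu v hv huv
    have hd : dist u v ^ 2 = 2 - 2 * ⟪u, v⟫ := by
      rw [dist_eq_norm, ← real_inner_self_eq_norm_sq, inner_sub_left, inner_sub_right,
        inner_sub_right, real_inner_self_eq_norm_sq, real_inner_self_eq_norm_sq, hX1 u hu,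
        hX1 v hv, real_inner_comm u v]
      ring
    have h2 : (0.957 : ℝ) ^ 2 ≤ dist u v ^ 2 := by
      rw [hd]; have := hsep u hu v hv huv; norm_num at this ⊢; linarith
    exact (pow_le_pow_iff_left₀ (by norm_num) dist_nonneg two_ne_zero).1 h2
  have hnorm := norm_lt_of_forall_inner_le_one hT hX1 hcard hdist hc
  -- five tight points
  obtain ⟨t, ht, ht5⟩ := Finset.exists_subset_card_eq (show 5 ≤ (tightSet X c).card by omega)
  have htc : Fintype.card t = 5 := by rw [Fintype.card_coe]; exact ht5
  set e := Fintype.equivFinOfCardEq htc with he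
  set y : Fin 5 → EuclideanSpace ℝ (Fin 3) := fun i => ((e.symm i : t) : EuclideanSpace ℝ (Fin 3))
    with hy
  have hyt : ∀ i, y i ∈ tightSet X c := fun i => ht (e.symm i).2
  have hyX : ∀ i, y i ∈ X := fun i => (mem_tightSet.1 (hyt i)).1
  have hcy : ∀ i, ⟪c, y i⟫ = 1 := fun i => (mem_tightSet.1 (hyt i)).2
  have hyinj : Function.Injective y := by
    intro i j hij
    have : e.symm i = e.symm j := Subtype.ext hij
    exact e.symm.injective this
  have hcn : 0 < ‖c‖ := by
    by_contra h0
    push Not at h0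
    have hc0 : c = 0 := norm_le_zero_iff.1 h0
    have h1 := hcy 0
    rw [hc0, inner_zero_left] at h1
    exact zero_ne_one h1
  refine tight_five_false (ca := 1 - 1 / (2 * (101 / 100 : ℝ) ^ 2))
    (μ := (1 - 1 / (2 * (101 / 100 : ℝ) ^ 2) - ((2 - 0.957 ^ 2) / 2) ^ 2) /
      (1 - ((2 - 0.957 ^ 2) / 2) ^ 2))
    (by norm_num) (by norm_num) ?_ y (fun i => hX1 _ (hyX i)) hcy
    (fun i j hij => hsep _ (hyX i) _ (hyX j) (fun h => hij (hyinj h))) ?_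
  · -- `μ < cos (2π/5) = (√5 − 1)/4`
    rw [cos_two_pi_div_five]
    have h5 : (2.236 : ℝ) < Real.sqrt 5 := by
      rw [show (2.236 : ℝ) = Real.sqrt (2.236 ^ 2) by rw [Real.sqrt_sq]; norm_num]
      exact Real.sqrt_lt_sqrt (by norm_num) (by norm_num)
    norm_num at h5 ⊢
    linarith
  · -- smallness: `ca − μ ≤ (1 − μ)/‖c‖²` from `‖c‖ < 2/(2 − 0.957²)`
    have hK : ‖c‖ ^ 2 < (2 / (2 - 0.957 ^ 2)) ^ 2 := pow_lt_pow_left₀ hnorm hcn.le two_ne_zero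
    have hc2 : 0 < ‖c‖ ^ 2 := by positivity
    rw [le_div_iff₀ hc2]
    norm_num at hK ⊢
    nlinarith [hK, hc2]

end Summit.AtomisticToContinuum.Crystallization.Theorems.Cap
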